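import Mathlib.MeasureTheory.Measure.Dirac
import Mathlib.MeasureTheory.Measure.WithDensity
import Mathlib.MeasureTheory.Integral.Bochner.Basic
import Mathlib.Topology.Algebra.Order.LiminfLimsup
import Literature.Analysis.FluidPDE.BBGKYMarginals
import Literature.Analysis.FluidPDE.HardSphereDynamics
import HarnessLib

-- provenance: harness21/H21/H21/Prelude/FluidKinetic/BoltzmannGradLimit.lean @ 12c92f1 (interim HEAD d8f2665); M5 mechanical rewrite
/-!
# The Boltzmann–Grad limit: scaling and modes of convergence
(trunk: FluidKinetic / T-KINETIC, item K5; notion `boltzmann_grad_limit_notion`)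

This file fixes the vocabulary in which Lanford-type theorems are stated
(Grad 1949; Gallagher–Saint-Raymond–Texier 2013 §2.3–2.4 and Theorem 8; Sznitman 1991
Prop. 2.2):

* the *Boltzmann–Grad scaling* `N ε^{d-1} → α` (`Kinetic.IsBoltzmannGradSequence`) and its
  exact variant `N ε^{d-1} = α` (`Kinetic.IsBoltzmannGradSequenceExact`);
* *mode A* (convergence of marginals, GST 2013 Thm 8): the `s`-particle marginals converge
  "locally uniformly off the diagonal in positions, in the sense of observables", i.e. after
  testing against a compactly supported continuous function of the velocities
  (`Kinetic.velocityAverage`), uniformly on `[0, T] × K` for compact `K ⊆ Kinetic.offDiag s`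
  (`Kinetic.TendstoMarginals`); *propagation of chaos* is mode A with the tensorised limit
  `f(t)^{⊗s}` (`Kinetic.PropagatesChaos`);
* *mode B* (law of large numbers, Sznitman 1991 Prop. 2.2; GST 2013 §2.4): the empirical
  measure `N⁻¹ ∑ δ_{z_i(t)}` (`Kinetic.empiricalMeasure`) converges in probability to
  `f(t, x, v) dx dv` (`Kinetic.TendstoEmpirical`);
* the initial law of the particle system with a density `W₀` w.r.t. the Liouville measure
  (`Kinetic.particleLaw`); its time-`t` law is `HardSphereFlow.lawAt`.

## Mathlib / H21 reuse

`Measure.dirac`, finite sums and `ℝ≥0∞`-scalar multiples of measures, `Measure.withDensity`,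
`integral_dirac`, `integral_finsetSum_measure`, `integral_smul_measure` are Mathlib's. Mathlib has
no empirical measure of a configuration and no Boltzmann–Grad scaling (grep `empirical`,
`Boltzmann.?Grad`: nothing relevant). Marginals, tensor powers, hard-sphere transport and flows are
K1–K3's (`Kinetic.nthMarginal`, `Kinetic.tensorPow`, `Kinetic.hsTransport`,
`Kinetic.HardSphereFlow`, `Kinetic.liouville`).

## Design choices

* The dimension index type `d` is an explicit argument of `IsBoltzmannGradSequence(Exact)`
  (it cannot be inferred from `α, N, ε`). The exponent `Fintype.card d - 1` is `ℕ`-subtraction;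
  all statements using it assume `2 ≤ Fintype.card d`, where it is the honest `d - 1`.
* In `TendstoMarginals` the double supremum over `t ∈ [0, T]`, `x_s ∈ K` is taken in `ℝ≥0∞`
  (via `ENNReal.ofReal |·|`), avoiding the junk value of `Real.sSup` on unbounded sets; the
  statement `Tendsto … (𝓝 0)` then says exactly `sup_{t, x_s} |…| → 0`.
* `empiricalMeasure` of a `0`-particle configuration is the zero measure (`(0 : ℝ≥0∞)⁻¹ = ∞`
  times `0`); `isProbabilityMeasure_empiricalMeasure` assumes `N ≠ 0`.
* `TendstoEmpirical` takes bare laws `Pk` and bare flows `Φk k : ℝ → Config → Config` so that it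
  applies verbatim to hard-sphere flows (`(Φ : HardSphereFlow G ε N).flow`) and to smooth
  short-range dynamics.
* Both `TendstoMarginals` and `TendstoEmpirical` quantify over `t ∈ Icc 0 T` and are therefore
  vacuous for `T < 0`; all consumers assume `0 < T`.
* In `TendstoMarginals.tendstoEmpirical` (mode A ⇒ mode B) the limit `f(t)` is assumed to be a
  probability density (`0 ≤ f t`, `∫ x, ∫ v, f t (x, v) = 1`), as in Sznitman 1991 Prop. 2.2;
  without it mass may escape to large velocities or concentrate near the position diagonal,
  which mode A does not see. The theorem also carries the standing instance hypotheses of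
  `ℝ^d` / `T^d` on the position space (`T2Space`, `LocallyCompactSpace`, `SigmaCompactSpace`,
  `BorelSpace`, `IsFiniteMeasureOnCompacts volume`, `NullSingletonClass volume`); the last one
  (points, hence the position diagonal, are null) is essential, the implication being false
  e.g. over `X = PUnit`. `nullSingletonClass_volume_unitAddCircle/unitAddTorus` supply the
  missing Mathlib fact for the torus (as theorems, not global instances on Mathlib types).

## References

* H. Grad, *On the kinetic theory of rarefied gases*, Comm. Pure Appl. Math. 2 (1949).
* I. Gallagher, L. Saint-Raymond, B. Texier, *From Newton to Boltzmann: hard spheres and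
  short-range potentials* (2013), §2.3–2.4, Theorem 8.
* A.-S. Sznitman, *Topics in propagation of chaos*, LNM 1464 (1991), Prop. 2.2.
-/

open MeasureTheory Set Filter Topology
open scoped ENNReal

namespace Literature.Analysis.FluidPDE

noncomputable section

section Kinetic

variable {d : Type*} {X : Type*}

/-! ## The Boltzmann–Grad scaling -/

section Scaling

variable [Fintype d]

/-- A sequence `(N_k, ε_k)` of particle numbers and diameters is in the *Boltzmann–Grad scaling*
with parameter `α`: `ε_k > 0`, `ε_k → 0` and `N_k ε_k^{d-1} → α` (Grad 1949; GST 2013 §2.3,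
(2.3.1)). The exponent `Fintype.card d - 1` is `ℕ`-subtraction; statements assume
`2 ≤ Fintype.card d`. [cite: Grad1949] -/
def IsBoltzmannGradSequence (d : Type*) [Fintype d] (α : ℝ) (N : ℕ → ℕ) (ε : ℕ → ℝ) : Prop :=
  (∀ k, 0 < ε k) ∧ Tendsto ε atTop (𝓝 0) ∧
    Tendsto (fun k => (N k : ℝ) * ε k ^ (Fintype.card d - 1)) atTop (𝓝 α)

/-- The *exact* Boltzmann–Grad scaling: `ε_k > 0`, `ε_k → 0` and `N_k ε_k^{d-1} = α` for every
`k` (GST 2013 §2.3, where `N ε^{d-1} ≡ 1`). Statements assume `2 ≤ Fintype.card d`. [cite: GST2013, §2.3  where  N ε^{d-1} ≡ 1] -/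
def IsBoltzmannGradSequenceExact (d : Type*) [Fintype d] (α : ℝ) (N : ℕ → ℕ) (ε : ℕ → ℝ) :
    Prop :=
  (∀ k, 0 < ε k) ∧ Tendsto ε atTop (𝓝 0) ∧ ∀ k, (N k : ℝ) * ε k ^ (Fintype.card d - 1) = α

/-- An exact Boltzmann–Grad sequence is a Boltzmann–Grad sequence (the constant sequence
converges). [folklore] -/
theorem IsBoltzmannGradSequenceExact.isBoltzmannGradSequence {α : ℝ} {N : ℕ → ℕ} {ε : ℕ → ℝ}
    (h : IsBoltzmannGradSequenceExact d α N ε) : IsBoltzmannGradSequence d α N ε := by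
  refine ⟨h.1, h.2.1, ?_⟩
  have : (fun k => (N k : ℝ) * ε k ^ (Fintype.card d - 1)) = fun _ => α := funext h.2.2
  rw [this]
  exact tendsto_const_nhds

/-- In a Boltzmann–Grad sequence with `α ≠ 0` and `2 ≤ d`, the number of particles tends to
infinity (GST 2013 §2.3). (Since `N_k ε_k^{d-1} ≥ 0`, the hypothesis forces `0 < α`.) [cite: GST2013, §2.3] -/
theorem IsBoltzmannGradSequence.tendsto_atTop (hd : 2 ≤ Fintype.card d) {α : ℝ} (hα : α ≠ 0)
    {N : ℕ → ℕ} {ε : ℕ → ℝ} (h : IsBoltzmannGradSequence d α N ε) :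
    Tendsto N atTop atTop := by
  obtain ⟨hpos, hε, hNε⟩ := h
  have hd' : Fintype.card d - 1 ≠ 0 := by omega
  have h1 : Tendsto (fun k => ε k ^ (Fintype.card d - 1)) atTop (𝓝[>] 0) := by
    refine tendsto_nhdsWithin_iff.2 ⟨?_, Eventually.of_forall fun k => pow_pos (hpos k) _⟩
    simpa [zero_pow hd'] using hε.pow (Fintype.card d - 1)
  have h2 : Tendsto (fun k => |(N k : ℝ) * ε k ^ (Fintype.card d - 1)| *
      (ε k ^ (Fintype.card d - 1))⁻¹) atTop atTop :=
    hNε.abs.pos_mul_atTop (abs_pos.2 hα) (tendsto_inv_nhdsGT_zero.comp h1)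
  rw [← tendsto_natCast_atTop_iff (R := ℝ)]
  refine h2.congr fun k => ?_
  have hk : 0 < ε k ^ (Fintype.card d - 1) := pow_pos (hpos k) _
  rw [abs_of_nonneg (by positivity), mul_inv_cancel_right₀ hk.ne']

end Scaling

/-! ## Mode A: convergence of marginals in the sense of observables -/

section Marginals

/-- The *off-diagonal* set of position configurations: `{x_s | x_i ≠ x_j for i ≠ j}`
(GST 2013 Thm 8: convergence holds locally uniformly on this open set), i.e. the injective
`x_s` (`mem_offDiag_iff_injective`). Not to be confused with Mathlib's `Set.offDiag`
(pairs `(a, b)` with `a ≠ b`); with `open Set` the two are disambiguated by the argument type. [cite: GST2013, Thm 8: convergence holds locally uniform] -/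
def offDiag (s : ℕ) : Set (Fin s → X) :=
  {xs | ∀ i j, i ≠ j → xs i ≠ xs j}

/-- Membership in `offDiag`. [folklore] -/
@[simp]
theorem mem_offDiag {s : ℕ} {xs : Fin s → X} :
    xs ∈ offDiag s ↔ ∀ i j, i ≠ j → xs i ≠ xs j := Iff.rfl

/-- `offDiag s` is the set of injective position configurations. [folklore] -/
theorem mem_offDiag_iff_injective {s : ℕ} {xs : Fin s → X} :
    xs ∈ offDiag s ↔ Function.Injective xs :=
  ⟨fun h _ _ hij => by_contra fun hne => h _ _ hne hij, fun h _ _ hij heq => hij (h heq)⟩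

variable [Fintype d]

/-- The *velocity average* of an `s`-particle function `F` against an observable `φ` of the
velocities, as a function of the positions:
`(I_φ F)(x_s) = ∫ φ(v_s) F(x_s, v_s) dv_s` (GST 2013 §2.4, Thm 8). Bochner integral over
`Fin s → ℝ^d`; junk value `0` if not integrable. [cite: GST2013, §2.4  Thm 8] -/
def velocityAverage {s : ℕ} (φ : (Fin s → EuclideanSpace ℝ d) → ℝ) (F : Config s d X → ℝ)
    (xs : Fin s → X) : ℝ :=
  ∫ vs : Fin s → EuclideanSpace ℝ d, φ vs * F fun i => (xs i, vs i)

variable [TopologicalSpace X]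

/-- *Mode A* (convergence of marginals in the sense of observables, GST 2013 Thm 8): the family
of marginals `F_k^{(s)}(t)` converges to `F^{(s)}(t)` if for every `s`, every continuous compactly
supported velocity observable `φ` and every compact `K ⊆ offDiag s`,
`sup_{t ∈ [0,T]} sup_{x_s ∈ K} |I_φ(F_k^{(s)}(t) - F^{(s)}(t))(x_s)| → 0` as `k → ∞`. The
supremum is taken in `ℝ≥0∞`. For `T < 0` the condition is vacuous (`[0, T] = ∅`), and the
clause `s = 0` only says `F_k^{(0)}(t) → F^{(0)}(t)` (constants); statements use `0 < T`. [cite: GST2013, Thm 8] -/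
def TendstoMarginals (Fk : ℕ → (s : ℕ) → ℝ → Config s d X → ℝ)
    (F : (s : ℕ) → ℝ → Config s d X → ℝ) (T : ℝ) : Prop :=
  ∀ (s : ℕ) (φ : (Fin s → EuclideanSpace ℝ d) → ℝ), Continuous φ → HasCompactSupport φ →
    ∀ K ⊆ offDiag (X := X) s, IsCompact K →
      Tendsto (fun k => ⨆ t ∈ Icc 0 T, ⨆ xs ∈ K,
        ENNReal.ofReal |velocityAverage φ (Fk k s t) xs - velocityAverage φ (F s t) xs|)
        atTop (𝓝 0)

/-- *Propagation of chaos* on `[0, T]` (GST 2013 Thm 8; Sznitman 1991 §I.2): the marginals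
`F_k^{(s)}(t)` converge, in mode A, to the tensor powers `f(t)^{⊗s}`. [cite: GST2013, Thm 8] -/
def PropagatesChaos (Fk : ℕ → (s : ℕ) → ℝ → Config s d X → ℝ)
    (f : ℝ → X × EuclideanSpace ℝ d → ℝ) (T : ℝ) : Prop :=
  TendstoMarginals Fk (fun s t => tensorPow s (f t)) T

/-- Propagation of chaos is mode-A convergence to the tensorised limit (unfolding lemma). [folklore] -/
theorem propagatesChaos_iff (Fk : ℕ → (s : ℕ) → ℝ → Config s d X → ℝ)
    (f : ℝ → X × EuclideanSpace ℝ d → ℝ) (T : ℝ) :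
    PropagatesChaos Fk f T ↔ TendstoMarginals Fk (fun s t => tensorPow s (f t)) T :=
  Iff.rfl

/-- If the marginals converge in mode A to a factorised family `F^{(s)}(t) = f(t)^{⊗s}`, chaos
propagates (GST 2013 Thm 8). [cite: GST2013, Thm 8] -/
theorem TendstoMarginals.propagatesChaos {Fk : ℕ → (s : ℕ) → ℝ → Config s d X → ℝ}
    {F : (s : ℕ) → ℝ → Config s d X → ℝ} {T : ℝ} (h : TendstoMarginals Fk F T)
    {f : ℝ → X × EuclideanSpace ℝ d → ℝ} (hF : ∀ t, IsFactorised (fun s => F s t) (f t)) :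
    PropagatesChaos Fk f T := by
  have : (fun s t => tensorPow s (f t)) = F := funext fun s => funext fun t => ((hF t) s).symm
  rw [PropagatesChaos, this]
  exact h

end Marginals

/-! ## Mode B: the empirical measure and convergence in probability -/

section Empirical

variable [MeasurableSpace X]

/-- The *empirical measure* of an `N`-particle configuration `z = (z_1, …, z_N)`:
`μ_z = N⁻¹ ∑_i δ_{z_i}`, a measure on the one-particle phase space `X × ℝ^d`
(Sznitman 1991 §I.2; GST 2013 §2.4). For `N = 0` this is the zero measure (junk). [cite: Sznitman1991, §I.2] -/
def empiricalMeasure {N : ℕ} (z : Config N d X) : Measure (X × EuclideanSpace ℝ d) :=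
  (N : ℝ≥0∞)⁻¹ • ∑ i, Measure.dirac (z i)

/-- Unfolding lemma for the empirical measure. [folklore] -/
theorem empiricalMeasure_eq {N : ℕ} (z : Config N d X) :
    empiricalMeasure z = (N : ℝ≥0∞)⁻¹ • ∑ i, Measure.dirac (z i) := rfl

/-- The empirical measure of a nonempty configuration is a probability measure. [folklore] -/
theorem isProbabilityMeasure_empiricalMeasure {N : ℕ} (hN : N ≠ 0) (z : Config N d X) :
    IsProbabilityMeasure (empiricalMeasure z) := by
  refine ⟨?_⟩
  simp only [empiricalMeasure, Measure.smul_apply, Measure.coe_finsetSum, Finset.sum_apply,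
    Measure.dirac_apply_of_mem (mem_univ _), Finset.sum_const, Finset.card_univ,
    Fintype.card_fin, nsmul_eq_mul, mul_one, smul_eq_mul]
  exact ENNReal.inv_mul_cancel (by exact_mod_cast hN) (ENNReal.natCast_ne_top N)

/-- Instance form of `isProbabilityMeasure_empiricalMeasure` (new instance on a new
definition; it overrides nothing in Mathlib). [folklore] -/
instance instIsProbabilityMeasureEmpiricalMeasure {N : ℕ} [NeZero N] (z : Config N d X) :
    IsProbabilityMeasure (empiricalMeasure z) :=
  isProbabilityMeasure_empiricalMeasure (NeZero.ne N) z

variable [Fintype d] [MeasurableSingletonClass X]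

/-- Integration against the empirical measure: `∫ φ dμ_z = N⁻¹ ∑_i φ(z_i)`
(Sznitman 1991 §I.2). (For `N = 0` both sides are `0`.) [cite: Sznitman1991, §I.2] -/
theorem integral_empiricalMeasure {N : ℕ} (z : Config N d X)
    (φ : X × EuclideanSpace ℝ d → ℝ) :
    ∫ y, φ y ∂empiricalMeasure z = (N : ℝ)⁻¹ * ∑ i, φ (z i) := by
  rw [empiricalMeasure, integral_smul_measure, integral_finsetSum_measure]
  · simp [integral_dirac, ENNReal.toReal_inv]
  · exact fun i _ => integrable_dirac (by simp)

end Empirical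

section Laws

variable [Fintype d] [MeasureSpace X] [TopologicalSpace X]

/-- *Mode B* (convergence in probability of the empirical measure; Sznitman 1991 Prop. 2.2,
GST 2013 §2.4): for laws `P_k` on `N_k`-particle configurations and dynamics `Φ_k(t)`, the
time-`t` empirical measure `μ_{Φ_k(t) z}` converges in `P_k`-probability, tested against every
continuous compactly supported `φ`, to `f(t, ·) dx dv`, for every `t ∈ [0, T]`:
`P_k {z | δ < |∫ φ dμ_{Φ_k(t) z} - ∫∫ φ f(t)|} → 0` for every `δ > 0`. The limit integral is the
iterated Bochner integral `∫ x, ∫ v` (junk value `0` where `f t (x, ·)` is not integrable).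
Vacuous for `T < 0`; statements use `0 < T`. [cite: Sznitman1991, Prop. 2.2  GST 2013 §2.4] -/
def TendstoEmpirical (Nk : ℕ → ℕ) (Pk : (k : ℕ) → Measure (Config (Nk k) d X))
    (Φk : (k : ℕ) → ℝ → Config (Nk k) d X → Config (Nk k) d X)
    (f : ℝ → X × EuclideanSpace ℝ d → ℝ) (T : ℝ) : Prop :=
  ∀ t ∈ Icc 0 T, ∀ φ : X × EuclideanSpace ℝ d → ℝ, Continuous φ → HasCompactSupport φ →
    ∀ δ > (0 : ℝ), Tendsto (fun k => Pk k {z | δ < |∫ y, φ y ∂empiricalMeasure (Φk k t z) -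
      ∫ x : X, ∫ v : EuclideanSpace ℝ d, φ (x, v) * f t (x, v)|}) atTop (𝓝 0)

/-- The initial law of the `N`-hard-sphere system with density `W₀` w.r.t. the Liouville measure:
`W₀ dZ_N` restricted to `D_ε^N` (GST 2013 §4.2, (6.1.2)). The law at time `t` is
`Φ.lawAt (particleLaw Φ W₀) t`. The flow `Φ` only fixes the parameters `G, ε, N`. [cite: GST2013, §4.2  (6.1.2] -/
def particleLaw {G : Geometry d X} {ε : ℝ} {N : ℕ} (_Φ : HardSphereFlow G ε N)
    (W₀ : Config N d X → ℝ) : Measure (Config N d X) :=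
  (liouville G N ε).withDensity fun z => ENNReal.ofReal (W₀ z)

/-- Unfolding lemma for `particleLaw`. [folklore] -/
theorem particleLaw_eq {G : Geometry d X} {ε : ℝ} {N : ℕ} (Φ : HardSphereFlow G ε N)
    (W₀ : Config N d X → ℝ) :
    particleLaw Φ W₀ = (liouville G N ε).withDensity fun z => ENNReal.ofReal (W₀ z) := rfl

/-- *Mode A implies mode B* (GST 2013 §2.4; Sznitman 1991 Prop. 2.2): if `N_k → ∞` and the
marginals `F_k^{(s)}(t) = (W_k ∘ Φ_k(-t))^{(s)}` of the time-evolved symmetric measurable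
probability densities `W_k` of `N_k` hard spheres converge in mode A to the chaotic family
`f(t)^{⊗s}`, where each `f(t)`, `t ∈ [0, T]`, is a *probability density* on `X × ℝ^d`
(`hf0`, `hf1`: Sznitman's "`u` is a probability measure"; the normalisation is stated for the
iterated Bochner integral `∫ x, ∫ v`, junk `0` where non-integrable, matching
`TendstoEmpirical`), then the empirical measure at time `t` converges in probability to `f(t)`.
Only `s = 1, 2` of mode A are used, together with `∫∫ f(t) = 1` (tightness: no mass escapes to
large velocities or to the position diagonal). Measurability of `W_k` (`hWm`) is what links
`particleLaw` to the transported density `hsTransport` via `HardSphereFlow.lawAt_withDensity`.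

*Standing hypotheses on the position space.* The statement is claimed only for position spaces
with the standing properties of `ℝ^d` and `T^d` (the only cases in GST 2013): `X` is Hausdorff,
locally compact, σ-compact, Borel, `volume` is finite on compacts and *singletons are
`volume`-null* (`NullSingletonClass`). The last one makes the position diagonal
`(volume ⊗ volume)`-null; without it mode A, which only tests compacts of `offDiag 2`, is blind
to mass concentrating on the diagonal and the implication fails (e.g. `X = PUnit` with a
mixture `½ g₁^{⊗N} + ½ g₂^{⊗N}`). Local/σ-compactness and finiteness on compacts make the
"pointwise on compacts" mode A determine the marginal measures. All these instances are found
by instance search for `EuclideanSpace ℝ d`; for `UnitAddTorus d` (`[Nonempty d]`) use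
`Kinetic.nullSingletonClass_volume_unitAddCircle` below together with Mathlib's
`MeasureTheory.Measure.pi_nullSingletonClass'`. [cite: GST2013, §2.4] -/
def TendstoMarginals.tendstoEmpirical : Prop :=
  ∀ [T2Space X] [LocallyCompactSpace X] [SigmaCompactSpace X] [BorelSpace X] [IsFiniteMeasureOnCompacts (volume : Measure X)] [NullSingletonClass (volume : Measure X)] {G : Geometry d X} {Nk : ℕ → ℕ} {εk : ℕ → ℝ} (hN : Tendsto Nk atTop atTop) (Φk : (k : ℕ) → HardSphereFlow G (εk k) (Nk k)) {Wk : (k : ℕ) → Config (Nk k) d X → ℝ} (hWs : ∀ k, IsSymmetricFn (Wk k)) (hWm : ∀ k, Measurable (Wk k)) (hW0 : ∀ k, 0 ≤ Wk k) (hWD : ∀ k, ∀ z ∉ hardSphereDomain G (Nk k) (εk k), Wk k z = 0) (hW1 : ∀ k, ∫ z, Wk k z = 1) {f : ℝ → X × EuclideanSpace ℝ d → ℝ} {T : ℝ} (hf0 : ∀ t ∈ Icc 0 T, 0 ≤ f t) (hf1 : ∀ t ∈ Icc 0 T, ∫ x : X, ∫ v : EuclideanSpace ℝ d, f t (x, v)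 = 1) (h : TendstoMarginals (fun k s t => nthMarginal (Nk k) s (hsTransport (Φk k) t (Wk k))) (fun s t => tensorPow s (f t)) T),
    TendstoEmpirical Nk (fun k => particleLaw (Φk k) (Wk k)) (fun k => (Φk k).flow) f T

end Laws

/-! ## Standing instances for the flat torus -/

section TorusInstances

/-- Points of the unit circle `UnitAddCircle = ℝ/ℤ` are Lebesgue-null: `volume {x} = 0`
(`{x}` is the closed ball of radius `0`, of volume `min 1 (2·0) = 0`, Mathlib's
`AddCircle.volume_closedBall`). Mathlib has `NullSingletonClass (volume : Measure ℝ)` but not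
this (grep `NullSingletonClass`); together with `MeasureTheory.Measure.pi_nullSingletonClass'`
it yields `NullSingletonClass (volume : Measure (UnitAddTorus d))` for `[Nonempty d]`, the
standing hypothesis of `TendstoMarginals.tendstoEmpirical` on `T^d` (GST 2013 §2.4). Stated as a
theorem (not a global instance on a Mathlib type); use `haveI` at call sites. [cite: GST2013, §2.4] -/
theorem nullSingletonClass_volume_unitAddCircle :
    NullSingletonClass (volume : Measure UnitAddCircle) :=
  ⟨fun x => by rw [← Metric.closedBall_zero (x := x), AddCircle.volume_closedBall]; simp⟩

/-- Points of the flat torus `T^d = UnitAddTorus d` (`d` nonempty) are Lebesgue-null. [folklore] -/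
theorem nullSingletonClass_volume_unitAddTorus (d : Type*) [Fintype d] [Nonempty d] :
    NullSingletonClass (volume : Measure (UnitAddTorus d)) :=
  haveI := nullSingletonClass_volume_unitAddCircle
  inferInstance

end TorusInstances

end Kinetic

end

end Literature.Analysis.FluidPDE
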